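/-
Copyright (c) 2026 the pub-hodgecm-mathlib formalisation cell (harness21).  Prover seat hodgecm-mathlib-K2E3-p12 (g2), Track B «K2-LIT» ∕ h413
(`stmt-HodgeConjecture-24833`), line `K2_E3_EllipticInputs`, unit U12-d «Harish-Chandra characters near a semisimple point»: the sub-socket U12-d₁
«the normalised character is bounded along the Cayley slice» — the LOSSLESS certificate (U12-d₁ ⟸ U12-d) and its two analysis-free first rungs
(regular `s`; central `s` from the Lie-algebra bound of ★ `K2E3NormalizedCharBddNearCentralOfLieBound`).  2026-09-03.
-/
import Summits.HodgeConjecture.HodgeConjecture.Theorems.K2E3NormalizedCharBddOnCayleySliceTrivialCases    -- ★ K2E1b-p01: `exists_nhds_zero_slice_subset` (+ ★ p855019 `…SemisimpleRegular` transitively)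
import Summits.HodgeConjecture.HodgeConjecture.Theorems.K2E3NormalizedCharBddNearCentralOfLieBound      -- ★ p855282: `continuous_detFactor`, `detFactor_zero`, `unitModulusChar_mul_detFactor_eq`
import HarnessLib

/-!
# K2_E3 road (h413 = stmt-HodgeConjecture-24833), unit U12-d, sub-socket U12-d₁ `sig_K2E3NormalizedCharBddOnCayleySlice`
# — LOSSLESSNESS (U12-d₁ ⟸ U12-d) AND THE FIRST RUNGS AT A REGULAR AND AT A CENTRAL POINT

Cell `pub/hodgecm-mathlib` (D-0151), Track B (21-frontier RULING «PUSH BOTH» 2026-09-03, director req624), seat K2E3-p12 (g2) = the line lead of row 12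
(12-S).  U12 SIGS ED. 3∕5 (`Cruxes/H413/Lines/K2_E3_EllipticInputsSigs_U12Characters.lean`, K2E3-plan (g1)) closes socket #12 = U12-d
`sig_K2E3NormalizedCharBddNearSemisimple` RELATIVE to the two sub-sockets U12-d₁ `sig_K2E3NormalizedCharBddOnCayleySlice` (:214, the analytic core,
Harish-Chandra 1999 Thm. 16.2 + Cor. 6.2 along the Cayley slice) and U12-d₂ `sig_K2E3CayleySliceConjugatesNhds` (★ p855654, K2E3-p12 (g0)), by ★ p855084
`K2E3NormalizedCharBddNearSemisimpleDescent.normalizedCharBddNear_of_slice`.  This file records, THEOREMS ONLY and in the sockets' bytes: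

* §1 **`normalizedCharBddOnCayleySlice_of_near`** — the converse direction: the CONCLUSION of U12-d at `s` (a bound on an open `U ∋ s`) implies the
  CONCLUSION of U12-d₁ at `s` (a bound along the slice `s·(1+Y)(1−Y)⁻¹`, `Y ∈ V`), for every `N`, every `s`, every `Θ`: slice points with `Y` near `0` lie
  in `U` (★ `K2E3NormalizedCharBddOnCayleySliceTrivialCases.exists_nhds_zero_slice_subset`, units topology of `U(H)(L⁺_v) ≤ GL_N`).  So ED. 3's cut is an
  EQUIVALENCE: given ★ U12-d₂, U12-d ⟺ U12-d₁ (the sub-socket is not stronger than the socket; audit point for K2E3-r01's B1 box).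
* §2 **`normalizedCharBddOnCayleySlice_of_isRegularElt`** — U12-d₁ with ONE extra hypothesis `IsRegularElt s` after the semisimplicity of `s` (every `N`):
  `Θ` is locally constant at `s` (socket hypothesis), the weight `√√‖u‖` is continuous (★ `exists_nhds_weight_le`), so ★ `exists_nhds_bound_of_eventually_eq`
  bounds `√√‖u‖·|Θ|` on an open `U ∋ s`, and §1's transport shrinks to the slice.  [HarishChandra1999 Thm. 16.3 at a regular point is this triviality.]
* §3 **`normalizedCharBddOnCayleySlice_central_of_lieBound`** — U12-d₁ at a CENTRAL point `s` (matrix `z • 1`) from the SAME Lie-algebra hypothesis `hLie`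
  as ★ p855282 `K2E3NormalizedCharBddNearCentralOfLieBound.normalizedCharBddNear_central_of_lieBound` («`(Π_w |disc(χ_Y)_w|_w)^{1∕4}·|Θ(y)| ≤ B` for `y = s·c(Y)`,
  `Y ∈ V` skew, `1 ± Y` units» = Harish-Chandra on `𝔤 = 𝔲_N` itself: Thm. 16.2 at the identity + Cor. 6.2), WITHOUT the covering hypothesis `hcov`: along the
  slice the group weight is `‖u‖ = Π_w|2^{N(N−1)}|_w · Π_w|disc(χ_Y)_w|_w ∕ Π_w|((det(1−Y)det(1+Y))^{N−1})_w|_w` (★ `unitModulusChar_mul_detFactor_eq`) and the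
  denominator is `> 1∕2` near `Y = 0` (★ `continuous_detFactor`, ★ `detFactor_zero`).  So the central first rung of U12-d₁ and of U12-d cost ONE Lie-algebra input.

THEOREMS ONLY (no definition ∕ instance ∕ notation ∕ named fact ∕ `sorry`); never imports `Cruxes/…/Lines`.
[HarishChandra1999AdmissibleDistributions, Thm. 16.3 p. 77, Thm. 16.2, Cor. 6.2 p. 45, §17, §21 p. 87] [Rogawski1990, §12.7 p. 192].
HONEST LABEL: HC_CM is proved only modulo the 7 printed citations (2 remaining named inputs: hLiu418 = stmt-HodgeConjecture-24832, h413 =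
stmt-HodgeConjecture-24833) until rung 0 closes; this is a `--supports stmt-HodgeConjecture-24833 --as helper` leaf and retires nothing by itself.

## References
* [HarishChandra1999AdmissibleDistributions] Harish-Chandra (notes by S. DeBacker and P. J. Sally, Jr.), *Admissible Invariant Distributions on Reductive
  p-adic Groups*, University Lecture Series 16, AMS (1999), Thm. 16.3, Thm. 16.2, Cor. 6.2, §17, §21.
* [Rogawski1990] J. Rogawski, *Automorphic Representations of Unitary Groups in Three Variables*, Annals of Math. Studies 123 (1990), §12.7.
-/

set_option autoImplicit false
set_option linter.dupNamespace false   -- `Summit.HodgeConjecture.HodgeConjecture.…` (D-0017 nested layout; lakefile exemption for Summits)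

noncomputable section

open NumberField IsDedekindDomain MeasureTheory Filter Topology
open scoped Matrix MatrixGroups NNReal
open Literature.NumberTheory.Rogawski1990 Literature.NumberTheory.Automorphic Literature.NumberTheory.Automorphic.UnitaryGroup
open Literature.NumberTheory.GaloisRepresentations Literature.NumberTheory.GaloisRepresentations.IsNonarchimedeanLocalField
open Summit.HodgeConjecture.HodgeConjecture.Cruxes.H413.K2E3NormalizedCharBddNearSemisimpleRegular
open Summit.HodgeConjecture.HodgeConjecture.Cruxes.H413.K2E3NormalizedCharBddOnCayleySliceTrivialCases
open Summit.HodgeConjecture.HodgeConjecture.Cruxes.H413.K2E3NormalizedCharBddNearCentralOfLieBound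

namespace Summit.HodgeConjecture.HodgeConjecture.Cruxes.H413.K2E3NormalizedCharBddOnCayleySliceOfNear

variable (L : Type) [Field L] [NumberField L] [IsCMField L] (N : ℕ) (H : Matrix (Fin N) (Fin N) L)
  (v : HeightOneSpectrum (𝓞 ↥(maximalRealSubfield L)))

/-! ## §1  LOSSLESSNESS: the conclusion of U12-d at `s` implies the conclusion of U12-d₁ at `s` -/

set_option maxHeartbeats 1600000 in
set_option synthInstance.maxHeartbeats 400000 in
/-- **U12-d₁ ⟸ U12-d, conclusion to conclusion (every `N`, every `s`, every `Θ`).**  If `√√‖u‖·|Θ g| ≤ B` for all `g` in an open `U ∋ s` and all admissible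
units `u` at `g` (the conclusion of socket #12 `sig_K2E3NormalizedCharBddNearSemisimple` at `s`), then the same bound holds at every `y ∈ U(H)(L⁺_v)` whose matrix is
`s·(1+Y)(1−Y)⁻¹` with `Y` in a suitable neighbourhood `V` of `0` in `M_N(L ⊗ L⁺_v)` (the conclusion of U12-d₁ at `s`; the skewness ∕ commutation ∕ unit clauses
of the slice go idle): ★ `exists_nhds_zero_slice_subset` puts such `y` inside `U`.  With ★ p855084 `normalizedCharBddNear_of_slice` + ★ p855654 (U12-d₂) this
makes U12 ED. 3's cut U12-d ⟸ {U12-d₁, U12-d₂} an equivalence U12-d ⟺ U12-d₁. [cite: HarishChandra1999AdmissibleDistributions, Thm. 16.3 p. 77; §18 p. 79] -/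
theorem normalizedCharBddOnCayleySlice_of_near (hHd : H.det ≠ 0) (Θ : (UnitaryGroup.cmDatum L N H).Local v → ℂ) (s : (UnitaryGroup.cmDatum L N H).Local v)
    (hnear : ∃ U : Set ((UnitaryGroup.cmDatum L N H).Local v), IsOpen U ∧ s ∈ U ∧
      ∃ B : ℝ, ∀ g ∈ U, ∀ u : (UnitaryGroup.LocalRing L v)ˣ,
        (u : UnitaryGroup.LocalRing L v) *
            (((g.val : GL (Fin N) (UnitaryGroup.LocalRing L v)).val : Matrix (Fin N) (Fin N) (UnitaryGroup.LocalRing L v)).det) ^ (N - 1) =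
          (((g.val : GL (Fin N) (UnitaryGroup.LocalRing L v)).val : Matrix (Fin N) (Fin N) (UnitaryGroup.LocalRing L v)).charpoly).discr →
        ((NNReal.sqrt (NNReal.sqrt (unitModulusChar (UnitaryGroup.LocalRing L v) u)) : ℝ≥0) : ℝ) * ‖Θ g‖ ≤ B) :
    ∃ V : Set (Matrix (Fin N) (Fin N) (UnitaryGroup.LocalRing L v)), V ∈ 𝓝 (0 : Matrix (Fin N) (Fin N) (UnitaryGroup.LocalRing L v)) ∧
      ∃ B : ℝ, ∀ y : (UnitaryGroup.cmDatum L N H).Local v,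
        (∃ Y ∈ V, (Y.map (UnitaryGroup.conjLocal L (IsCMField.complexConj L) v))ᵀ * ((UnitaryGroup.adelicForm L N H).map (UnitaryGroup.adeleToLocal L v)) = -(((UnitaryGroup.adelicForm L N H).map (UnitaryGroup.adeleToLocal L v)) * Y) ∧
          ((s.val : GL (Fin N) (UnitaryGroup.LocalRing L v)).val : Matrix (Fin N) (Fin N) (UnitaryGroup.LocalRing L v)) * Y = Y * ((s.val : GL (Fin N) (UnitaryGroup.LocalRing L v)).val : Matrix (Fin N) (Fin N) (UnitaryGroup.LocalRing L v)) ∧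
          IsUnit (1 - Y) ∧ IsUnit (1 + Y) ∧
          ((y.val : GL (Fin N) (UnitaryGroup.LocalRing L v)).val : Matrix (Fin N) (Fin N) (UnitaryGroup.LocalRing L v)) = ((s.val : GL (Fin N) (UnitaryGroup.LocalRing L v)).val : Matrix (Fin N) (Fin N) (UnitaryGroup.LocalRing L v)) * ((1 + Y) * (1 - Y)⁻¹)) →
        ∀ u : (UnitaryGroup.LocalRing L v)ˣ,
        (u : UnitaryGroup.LocalRing L v) *
            (((y.val : GL (Fin N) (UnitaryGroup.LocalRing L v)).val : Matrix (Fin N) (Fin N) (UnitaryGroup.LocalRing L v)).det) ^ (N - 1) =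
          (((y.val : GL (Fin N) (UnitaryGroup.LocalRing L v)).val : Matrix (Fin N) (Fin N) (UnitaryGroup.LocalRing L v)).charpoly).discr →
        ((NNReal.sqrt (NNReal.sqrt (unitModulusChar (UnitaryGroup.LocalRing L v) u)) : ℝ≥0) : ℝ) * ‖Θ y‖ ≤ B := by
  obtain ⟨U, hUo, hsU, B, hB⟩ := hnear
  obtain ⟨V, hV, hVU⟩ := exists_nhds_zero_slice_subset L N H v hHd s (hUo.mem_nhds hsU)
  refine ⟨V, hV, B, fun y hy u hu => ?_⟩
  obtain ⟨Y, hYV, -, -, -, -, hyY⟩ := hy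
  exact hB y (hVU y Y hYV hyY) u hu

/-! ## §2  U12-d₁ AT A REGULAR POINT `s` (every `N`) -/

set_option maxHeartbeats 1600000 in
set_option synthInstance.maxHeartbeats 400000 in
open scoped Classical in
/-- **U12-d₁ «NORMALISED CHARACTER BOUNDED ON THE CAYLEY SLICE» AT A REGULAR POINT.**  Binders and conclusion of the sub-socket
`sig_K2E3NormalizedCharBddOnCayleySlice` (U12 SIGS ED. 5 :214) token for token, plus the hypothesis `IsRegularElt s` after the semisimplicity of `s`.  Proof: `Θ` is
locally constant at the regular point `s` (socket hypothesis `hloc`), so ★ `exists_nhds_bound_of_eventually_eq` (continuity of the weight `√√‖u‖`, ★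
`exists_nhds_weight_le`) bounds `√√‖u‖·|Θ g|` on an open `U ∋ s`; §1 transports the bound to the slice.  `Θ ∈ L¹_loc`, `π`, the trace identity, semisimplicity and
the skewness ∕ commutation clauses go idle. [cite: HarishChandra1999AdmissibleDistributions, Thm. 16.3 p. 77; §17] [cite: Rogawski1990, §12.7 p. 192] -/
theorem normalizedCharBddOnCayleySlice_of_isRegularElt :
  ∀ (L : Type) [Field L] [NumberField L] [IsCMField L] (N : ℕ) (H : Matrix (Fin N) (Fin N) L),
    (H.map (cmConjRingHom L))ᵀ = H → H.det ≠ 0 →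
    ∀ (v : HeightOneSpectrum (𝓞 ↥(maximalRealSubfield L)))
      [MeasurableSpace ((UnitaryGroup.cmDatum L N H).Local v)] [BorelSpace ((UnitaryGroup.cmDatum L N H).Local v)]
      (μ : Measure ((UnitaryGroup.cmDatum L N H).Local v)) [μ.IsHaarMeasure]
      (c : IrrClass ((UnitaryGroup.cmDatum L N H).Local v)) (Θ : (UnitaryGroup.cmDatum L N H).Local v → ℂ),
      LocallyIntegrable Θ μ →
      (∀ x : (UnitaryGroup.cmDatum L N H).Local v,
        IsRegularElt (x.val : GL (Fin N) (UnitaryGroup.LocalRing L v)) → ∀ᶠ y in 𝓝 x, Θ y = Θ x) →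
      (∀ φ : (UnitaryGroup.cmDatum L N H).Local v → ℂ, IsLocSmooth φ → c.smoothTrace μ φ = ∫ x, φ x * Θ x ∂μ) →
    ∀ s : (UnitaryGroup.cmDatum L N H).Local v, Module.End.IsSemisimple (Matrix.toLin' ((s.val : GL (Fin N) (UnitaryGroup.LocalRing L v)).val : Matrix (Fin N) (Fin N) (UnitaryGroup.LocalRing L v))) →
      IsRegularElt (s.val : GL (Fin N) (UnitaryGroup.LocalRing L v)) →
      ∃ V : Set (Matrix (Fin N) (Fin N) (UnitaryGroup.LocalRing L v)), V ∈ 𝓝 (0 : Matrix (Fin N) (Fin N) (UnitaryGroup.LocalRing L v)) ∧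
      ∃ B : ℝ, ∀ y : (UnitaryGroup.cmDatum L N H).Local v,
        (∃ Y ∈ V, (Y.map (UnitaryGroup.conjLocal L (IsCMField.complexConj L) v))ᵀ * ((UnitaryGroup.adelicForm L N H).map (UnitaryGroup.adeleToLocal L v)) = -(((UnitaryGroup.adelicForm L N H).map (UnitaryGroup.adeleToLocal L v)) * Y) ∧
          ((s.val : GL (Fin N) (UnitaryGroup.LocalRing L v)).val : Matrix (Fin N) (Fin N) (UnitaryGroup.LocalRing L v)) * Y = Y * ((s.val : GL (Fin N) (UnitaryGroup.LocalRing L v)).val : Matrix (Fin N) (Fin N) (UnitaryGroup.LocalRing L v)) ∧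
          IsUnit (1 - Y) ∧ IsUnit (1 + Y) ∧
          ((y.val : GL (Fin N) (UnitaryGroup.LocalRing L v)).val : Matrix (Fin N) (Fin N) (UnitaryGroup.LocalRing L v)) = ((s.val : GL (Fin N) (UnitaryGroup.LocalRing L v)).val : Matrix (Fin N) (Fin N) (UnitaryGroup.LocalRing L v)) * ((1 + Y) * (1 - Y)⁻¹)) →
        ∀ u : (UnitaryGroup.LocalRing L v)ˣ,
        (u : UnitaryGroup.LocalRing L v) *
            (((y.val : GL (Fin N) (UnitaryGroup.LocalRing L v)).val : Matrix (Fin N) (Fin N) (UnitaryGroup.LocalRing L v)).det) ^ (N - 1) =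
          (((y.val : GL (Fin N) (UnitaryGroup.LocalRing L v)).val : Matrix (Fin N) (Fin N) (UnitaryGroup.LocalRing L v)).charpoly).discr →
        ((NNReal.sqrt (NNReal.sqrt (unitModulusChar (UnitaryGroup.LocalRing L v) u)) : ℝ≥0) : ℝ) * ‖Θ y‖ ≤ B := by
  intro L _ _ _ N H _ hHd v _ _ μ _ c Θ _ hloc _ s _ hreg
  -- `Θ` is locally constant at the regular point `s`: a bound on an open `U ∋ s`, then §1
  obtain ⟨U, hUo, hsU, B, hB⟩ := exists_nhds_bound_of_eventually_eq L N H v Θ s (hloc s hreg)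
  exact normalizedCharBddOnCayleySlice_of_near L N H v hHd Θ s ⟨U, hUo, hsU, B, hB⟩

/-! ## §3  U12-d₁ AT A CENTRAL POINT from the Lie-algebra bound of ★ `K2E3NormalizedCharBddNearCentralOfLieBound` (no covering hypothesis) -/

set_option maxHeartbeats 1600000 in
set_option synthInstance.maxHeartbeats 400000 in
/-- **U12-d₁ at a CENTRAL point `s` (matrix `z·1`) from the Lie-algebra bound along the Cayley slice.**  The hypothesis `hLie` is BYTE-IDENTICAL with the
`hLie` of ★ `normalizedCharBddNear_central_of_lieBound` (socket #12 at a central point): «`(Π_w |disc(χ_Y)_w|_w)^{1∕4}·|Θ(y)| ≤ B` whenever `matrix(y) = s·c(Y)`,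
`Y ∈ V` skew, `[s, Y] = 0`, `1 ± Y` units» — Harish-Chandra's Thm. 16.2 at the identity + Cor. 6.2 on `𝔤 = 𝔲_N`, in the weight `|disc(χ_Y)|^{1∕4}`.  Conclusion =
the conclusion of U12-d₁ at `s`.  Proof: shrink `V` so that `Π_w|((det(1−Y)det(1+Y))^{N−1})_w|_w > 1∕2` (★ `continuous_detFactor`, ★ `detFactor_zero`); at a slice
point `y = z·c(Y)` the admissible unit satisfies `‖u‖·Π_w|((det(1−Y)det(1+Y))^{N−1})_w|_w = Π_w|2^{N(N−1)}|_w·Π_w|disc(χ_Y)_w|_w` (★ `unitModulusChar_mul_detFactor_eq`),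
so `√√‖u‖·|Θ y| ≤ √√(2·Π_w|2^{N(N−1)}|_w)·max B 0`.  No covering (U12-d₂) is used: along the slice the conjugator is `1`.
[cite: HarishChandra1999AdmissibleDistributions, Thm. 16.3 p. 77; Thm. 16.2; Cor. 6.2 p. 45; §17] [cite: Rogawski1990, §12.7 p. 193] -/
theorem normalizedCharBddOnCayleySlice_central_of_lieBound (Θ : (UnitaryGroup.cmDatum L N H).Local v → ℂ)
    (s : (UnitaryGroup.cmDatum L N H).Local v) (z : (UnitaryGroup.LocalRing L v)ˣ) (hz : ((s.val : GL (Fin N) (UnitaryGroup.LocalRing L v)).val : Matrix (Fin N) (Fin N) (UnitaryGroup.LocalRing L v)) = (z : UnitaryGroup.LocalRing L v) • (1 : Matrix (Fin N) (Fin N) (UnitaryGroup.LocalRing L v)))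
    (hLie : ∃ V : Set (Matrix (Fin N) (Fin N) (UnitaryGroup.LocalRing L v)), V ∈ 𝓝 (0 : Matrix (Fin N) (Fin N) (UnitaryGroup.LocalRing L v)) ∧ ∃ B : ℝ, ∀ y : (UnitaryGroup.cmDatum L N H).Local v, ∀ Y ∈ V,
        (Y.map (UnitaryGroup.conjLocal L (IsCMField.complexConj L) v))ᵀ * ((UnitaryGroup.adelicForm L N H).map (UnitaryGroup.adeleToLocal L v)) = -(((UnitaryGroup.adelicForm L N H).map (UnitaryGroup.adeleToLocal L v)) * Y) →
        ((s.val : GL (Fin N) (UnitaryGroup.LocalRing L v)).val : Matrix (Fin N) (Fin N) (UnitaryGroup.LocalRing L v)) * Y = Y * ((s.val : GL (Fin N) (UnitaryGroup.LocalRing L v)).val : Matrix (Fin N) (Fin N) (UnitaryGroup.LocalRing L v)) → IsUnit (1 - Y) → IsUnit (1 + Y) →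
        ((y.val : GL (Fin N) (UnitaryGroup.LocalRing L v)).val : Matrix (Fin N) (Fin N) (UnitaryGroup.LocalRing L v)) = ((s.val : GL (Fin N) (UnitaryGroup.LocalRing L v)).val : Matrix (Fin N) (Fin N) (UnitaryGroup.LocalRing L v)) * ((1 + Y) * (1 - Y)⁻¹) →
        ((NNReal.sqrt (NNReal.sqrt (∏ w : PlacesOver L v, normAbs (w.1.adicCompletion L) ((Y.charpoly.discr) w))) : ℝ≥0) : ℝ) * ‖Θ y‖ ≤ B) :
    ∃ V : Set (Matrix (Fin N) (Fin N) (UnitaryGroup.LocalRing L v)), V ∈ 𝓝 (0 : Matrix (Fin N) (Fin N) (UnitaryGroup.LocalRing L v)) ∧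
      ∃ B : ℝ, ∀ y : (UnitaryGroup.cmDatum L N H).Local v,
        (∃ Y ∈ V, (Y.map (UnitaryGroup.conjLocal L (IsCMField.complexConj L) v))ᵀ * ((UnitaryGroup.adelicForm L N H).map (UnitaryGroup.adeleToLocal L v)) = -(((UnitaryGroup.adelicForm L N H).map (UnitaryGroup.adeleToLocal L v)) * Y) ∧
          ((s.val : GL (Fin N) (UnitaryGroup.LocalRing L v)).val : Matrix (Fin N) (Fin N) (UnitaryGroup.LocalRing L v)) * Y = Y * ((s.val : GL (Fin N) (UnitaryGroup.LocalRing L v)).val : Matrix (Fin N) (Fin N) (UnitaryGroup.LocalRing L v)) ∧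
          IsUnit (1 - Y) ∧ IsUnit (1 + Y) ∧
          ((y.val : GL (Fin N) (UnitaryGroup.LocalRing L v)).val : Matrix (Fin N) (Fin N) (UnitaryGroup.LocalRing L v)) = ((s.val : GL (Fin N) (UnitaryGroup.LocalRing L v)).val : Matrix (Fin N) (Fin N) (UnitaryGroup.LocalRing L v)) * ((1 + Y) * (1 - Y)⁻¹)) →
        ∀ u : (UnitaryGroup.LocalRing L v)ˣ,
        (u : UnitaryGroup.LocalRing L v) *
            (((y.val : GL (Fin N) (UnitaryGroup.LocalRing L v)).val : Matrix (Fin N) (Fin N) (UnitaryGroup.LocalRing L v)).det) ^ (N - 1) =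
          (((y.val : GL (Fin N) (UnitaryGroup.LocalRing L v)).val : Matrix (Fin N) (Fin N) (UnitaryGroup.LocalRing L v)).charpoly).discr →
        ((NNReal.sqrt (NNReal.sqrt (unitModulusChar (UnitaryGroup.LocalRing L v) u)) : ℝ≥0) : ℝ) * ‖Θ y‖ ≤ B := by
  obtain ⟨V, hV, B, hB⟩ := hLie
  -- the unit factor and its lower bound `1∕2` near `0`
  set Mf : Matrix (Fin N) (Fin N) (UnitaryGroup.LocalRing L v) → ℝ≥0 := fun Y =>
    ∏ w : PlacesOver L v, normAbs (w.1.adicCompletion L) ((((1 - Y).det * (1 + Y).det) ^ (N - 1)) w) with hMf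
  have hMc : Continuous Mf := continuous_detFactor L N v
  have hM0 : Mf 0 = 1 := detFactor_zero L N v
  have hVM : Mf ⁻¹' Set.Ioi (1 / 2) ∈ 𝓝 (0 : Matrix (Fin N) (Fin N) (UnitaryGroup.LocalRing L v)) := by
    refine (hMc.isOpen_preimage _ isOpen_Ioi).mem_nhds ?_
    rw [Set.mem_preimage, hM0, Set.mem_Ioi]
    exact one_half_lt_one
  -- the constant `K = Π_w |2^{N(N−1)}|_w` and the final bound
  set K : ℝ≥0 := ∏ w : PlacesOver L v, normAbs (w.1.adicCompletion L) (((2 : UnitaryGroup.LocalRing L v) ^ (N * (N - 1))) w) with hK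
  refine ⟨V ∩ Mf ⁻¹' Set.Ioi (1 / 2), Filter.inter_mem hV hVM, ((NNReal.sqrt (NNReal.sqrt (2 * K)) : ℝ≥0) : ℝ) * max B 0, ?_⟩
  rintro y ⟨Y, hYV', hskew, hcomm, h1, h2, hy⟩ u hu
  have hYV : Y ∈ V := hYV'.1
  have hYM : 1 / 2 < Mf Y := hYV'.2
  -- the unit relation at `y = z • c(Y)`
  have hyz : ((y.val : GL (Fin N) (UnitaryGroup.LocalRing L v)).val : Matrix (Fin N) (Fin N) (UnitaryGroup.LocalRing L v)) = (z : UnitaryGroup.LocalRing L v) • ((1 + Y) * (1 - Y)⁻¹) := by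
    rw [hy, hz, Matrix.smul_mul, Matrix.one_mul]
  have hu' : (u : UnitaryGroup.LocalRing L v) * ((z : UnitaryGroup.LocalRing L v) • ((1 + Y) * (1 - Y)⁻¹)).det ^ (N - 1) = ((z : UnitaryGroup.LocalRing L v) • ((1 + Y) * (1 - Y)⁻¹)).charpoly.discr := by
    rw [← hyz]; exact hu
  have hmod := unitModulusChar_mul_detFactor_eq L N v Y h1 z u hu'
  -- `‖u‖ ≤ 2 K D`
  set D : ℝ≥0 := ∏ w : PlacesOver L v, normAbs (w.1.adicCompletion L) ((Y.charpoly.discr) w) with hD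
  have hle : unitModulusChar (UnitaryGroup.LocalRing L v) u ≤ 2 * K * D := by
    have h2 : unitModulusChar (UnitaryGroup.LocalRing L v) u * (1 / 2) ≤ unitModulusChar (UnitaryGroup.LocalRing L v) u * Mf Y :=
      mul_le_mul_of_nonneg_left hYM.le (zero_le)
    rw [hmod] at h2
    calc unitModulusChar (UnitaryGroup.LocalRing L v) u = unitModulusChar (UnitaryGroup.LocalRing L v) u * (1 / 2) * 2 := by rw [mul_assoc, one_div, inv_mul_cancel₀ (two_ne_zero), mul_one]
      _ ≤ K * D * 2 := mul_le_mul_of_nonneg_right h2 (zero_le)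
      _ = 2 * K * D := by ring
  have hsqrt : NNReal.sqrt (NNReal.sqrt (unitModulusChar (UnitaryGroup.LocalRing L v) u)) ≤ NNReal.sqrt (NNReal.sqrt (2 * K)) * NNReal.sqrt (NNReal.sqrt D) := by
    rw [← NNReal.sqrt_mul, ← NNReal.sqrt_mul]
    exact NNReal.sqrt_le_sqrt.2 (NNReal.sqrt_le_sqrt.2 hle)
  have hLie := hB y Y hYV hskew hcomm h1 h2 hy
  have hB0 : B ≤ max B 0 := le_max_left _ _
  calc ((NNReal.sqrt (NNReal.sqrt (unitModulusChar (UnitaryGroup.LocalRing L v) u)) : ℝ≥0) : ℝ) * ‖Θ y‖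
      ≤ (((NNReal.sqrt (NNReal.sqrt (2 * K)) * NNReal.sqrt (NNReal.sqrt D) : ℝ≥0)) : ℝ) * ‖Θ y‖ :=
        mul_le_mul_of_nonneg_right (NNReal.coe_le_coe.2 hsqrt) (norm_nonneg _)
    _ = ((NNReal.sqrt (NNReal.sqrt (2 * K)) : ℝ≥0) : ℝ) * ((((NNReal.sqrt (NNReal.sqrt D)) : ℝ≥0) : ℝ) * ‖Θ y‖) := by
        rw [NNReal.coe_mul, mul_assoc]
    _ ≤ ((NNReal.sqrt (NNReal.sqrt (2 * K)) : ℝ≥0) : ℝ) * max B 0 :=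
        mul_le_mul_of_nonneg_left (hLie.trans hB0) (NNReal.coe_nonneg _)

end Summit.HodgeConjecture.HodgeConjecture.Cruxes.H413.K2E3NormalizedCharBddOnCayleySliceOfNear

end
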